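import Summits.AtomisticToContinuum.Crystallization.Theses.HullExactificationCascade

/-!
# Route HullExactificationCascade — item `Assembly` (stmt-AtomisticToContinuum-12096)

The assembly item of route `HullExactificationCascade` (sub-problem `Crystallization` of the
summit `AtomisticToContinuum`) is the implication

  `ZeroDefectDensity → HcpLandscapeGap → RobustBarlowTemplate → HullGoodEverywhere →
   HullBulkOptimal → HullDefectDensityZero → HullExactShells → ExactHcpLocalTheorem →
   HullPeriodicCrystallizes → CrysEnergyUpper → CrysPeriodicBddBelow → HullEnergyLowerBound →
   Crystallization`,

i.e. the twelve binders A, B, C, D, E, F₀, F, G, H, I₁, I₂, J of the route's deciding theorem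
`Summit.AtomisticToContinuum.Crystallization.Theses.HullExactificationCascade.closes`, in the
same order, imply the sub-problem statement `_root_.Crystallization`.  `closes` is sorry-free in
the Theses file (axioms `propext`, `Classical.choice`, `Quot.sound`; pure logic plus the proved
tree facts `BlancLewin2015_8_holds`, `LennardJonesGroundStatesExist_holds`,
`hcpPeriodicConfiguration_points` and `ciInf_le`), so the item is settled by unfolding `Assembly`
and invoking `closes`.

Logic of `closes`, for the record.  From B obtain the relaxed hcp parameters `(a, h)` in the box
and the density-priced gap; `BlancLewin2015_8_holds` gives `e` with `E(N)/N → e`, hence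
`liminf = limsup = e`; I₁ gives `e ≤ ⨅_Q e(Q)` and `ciInf_le` with I₂ gives `⨅_Q e(Q) ≤ e(hcp a h)`.
(i) Along a ground-state sequence (`LennardJonesGroundStatesExist_holds`), D (fed by A) yields a
δ-separated, everywhere-good, relatively dense hull element `S ∋ 0`; C templates it; B specialised
to `S` and E give J's hypotheses, so `e(hcp a h) ≤ e`, whence `e = e(hcp a h) = ⨅`, `IsLeast`, and
`HasPeriodicGroundStateEnergy`.  (ii) For an arbitrary ground-state sequence the same data feed F₀,
then F produces a hull element with exactly-hcp shells, G identifies it as an isometric image of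
`hcpStacking a h = (hcpPeriodicConfiguration ha hh).points`, and H gives the `IsCrystallizing`
clause.

Nothing else is proved here; the twelve hypotheses remain the route's items.
-/

namespace Summit.AtomisticToContinuum.Crystallization.Theorems

open Summit.AtomisticToContinuum.Crystallization.Theses.HullExactificationCascade

/-- **Item `Assembly`** (stmt-AtomisticToContinuum-12096, route HullExactificationCascade): the
twelve binders `ZeroDefectDensity`, `HcpLandscapeGap`, `RobustBarlowTemplate`,
`HullGoodEverywhere`, `HullBulkOptimal`, `HullDefectDensityZero`, `HullExactShells`,
`ExactHcpLocalTheorem`, `HullPeriodicCrystallizes`, `CrysEnergyUpper`, `CrysPeriodicBddBelow`,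
`HullEnergyLowerBound` imply `Crystallization` — literally the route's deciding theorem
`Theses.HullExactificationCascade.closes`. [folklore] -/
theorem hullExactificationCascade_assembly_proof :
    Theses.HullExactificationCascade.Assembly := by
  unfold Theses.HullExactificationCascade.Assembly
  exact closes

end Summit.AtomisticToContinuum.Crystallization.Theorems
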